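import Literature.NumberTheory.EllipticCurves.HondaStrongIsomorphismAllPrimesProofs
import Literature.NumberTheory.EllipticCurves.SerreOpenImageOrdinaryInertiaProofs
import Literature.NumberTheory.EllipticCurves.Rank1Residual.Predicates
import HarnessLib

/-!
# Honda transport for the crux `SignedTransportAtTwo` (stmt-BirchSwinnertonDyer-20333, route `ThetaPartnerAtTwo`, line
# `bridge`): two elliptic curves over `ℚ` with good reduction at `p` and THE SAME `a_p` have formal groups that are STRONGLY
# ISOMORPHIC OVER `ℤ_p` — `p = 2` included; on the theta habitat (`a₂(W) = a₂(A) = 0`) the formal groups of `W` and of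
# its CM partner `A` at `2` are strongly isomorphic over `ℤ₂`
# (lead prover bsd-wall-tp2-p1 g3; `--supports stmt-BirchSwinnertonDyer-20333`; route-independent, closes nothing)

HONEST FRAMING. THEOREMS ONLY (power-series statements about formal logarithms); nothing about any Selmer group is
asserted; BSD is not proved by any of this. No import of any route file.

WHY. What is left of the registered algebraic stub `stub_sel2` of line `bridge` v8 (after p535022, p536648, p537955) is
the comparison of the LOCAL signed conditions of `W` and `A` at `2` along `W[2] ≅ A[2]` — B. D. Kim 2009, Prop. 2.11–2.12,
whose proof (p. 186) is "`Ê` and `Ê'` have the same Honda type `X² + p`" (Kobayashi 2003, Thm. 8.4 ⇐ Honda 1970, Thm. 9):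
Kobayashi's `E^±(k_n)` are cut out inside the FORMAL GROUP, so a `ℤ_p`-isomorphism of formal groups transports them. This
file proves that input at the power-series level, for EVERY good prime (`p = 2` included), from the tree's Honda theory
(`HondaStrongIsomorphismAllPrimesProofs`: `log_E` is of Honda type `p − a_pT + T²`; `Literature.RingTheory.FormalGroups`:
Honda's Thm. 2 `norm_coeff_le_one_of_subst_eq` — two series of the same type differ by an INTEGRAL substitution):

* `exists_padicInt_formalLog_subst_eq_formalLog` — for globally minimal elliptic `W, A / ℚ`, a prime `p ∤ Δ_min(W)·Δ_min(A)`
  with `a_p(W) = a_p(A)`: there is `ψ ∈ Xℤ_p⟦X⟧` (i.e. `ψ ∈ Xℚ_p⟦X⟧` with `p`-integral coefficients) with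
  `log_{A ⊗ ℚ_p} ∘ ψ = log_{W ⊗ ℚ_p}` — `ψ = exp_A ∘ log_W : Ŵ → Â` is a strong isomorphism of formal groups over `ℤ_p`
  (Honda 1970, Thm. 2 with Thm. 9; Kobayashi 2003, Thm. 8.4 for `a_p = 0`);
* `exists_padicInt_formalLog_subst_eq_formalLog_two_of_goodSS` — the habitat case: `W`, `A` good supersingular at `2`
  with `a₂(W) = a₂(A) = 0` ⇒ `Ŵ ≅ Â` strongly over `ℤ₂` (both of Honda type `2 + T²`).

What this does NOT do: the dictionary from the power series `ψ` to Kobayashi's trace-condition subgroups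
`signedLocalPointsOfEmb` of the LOCAL POINTS over the layers `k_n` of the cyclotomic `ℤ₂`-extension of `ℚ₂` (the tree's
`FormalGroupChart*` files evaluate formal series on points; that transport is the successor's work).

References: [Honda1970] Thm. 2 (p. 223), §6.2 Thm. 9 (pp. 240–241); [Kobayashi2003] Thm. 8.4; [BDKim2009] p. 186 (proof
of Prop. 2.11–2.12); [Hazewinkel1978] Ch. I §2.2.
-/

set_option autoImplicit false
-- D-0017: single-problem summit, so `Summit.BirchSwinnertonDyer.BirchSwinnertonDyer.…` repeats a namespace BY DESIGN.
set_option linter.dupNamespace false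

noncomputable section

open scoped Classical

open PowerSeries WeierstrassCurve Literature.RingTheory.FormalGroups Literature.NumberTheory.EllipticCurves
  Literature.NumberTheory.EllipticCurves.Rank1Residual

namespace Summit.BirchSwinnertonDyer.BirchSwinnertonDyer.Theorems.SignedTransportAtTwo

variable {p : ℕ} [hp : Fact p.Prime]

/-- **Honda transport (every good prime, `p = 2` included): equal `a_p` ⇒ strongly isomorphic formal groups over `ℤ_p`.**
For globally minimal elliptic `W, A / ℚ` with `p ∤ Δ_min(W)`, `p ∤ Δ_min(A)` and `a_p(W) = a_p(A)` there is `ψ ∈ Xℚ_p⟦X⟧`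
with `p`-integral coefficients such that `log_{A ⊗ ℚ_p}(ψ) = log_{W ⊗ ℚ_p}`: both logarithms are of Honda type
`p − a_pT + T²` (`norm_coeff_hondaShift_subst_formalLog_le_one'`), so `ψ = log_A⁻¹ ∘ log_W` is integral by Honda's
Thm. 2 (`norm_coeff_le_one_of_subst_eq`). [cite: Honda1970, Thm. 2 (p. 223) and Thm. 9 (pp. 240–241)]
[cite: Kobayashi2003, Thm. 8.4] -/
theorem exists_padicInt_formalLog_subst_eq_formalLog (W A : WeierstrassCurve ℚ) [W.IsElliptic] [W.IsGloballyMinimal]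
    [A.IsElliptic] [A.IsGloballyMinimal] (hW : ¬ (p : ℤ) ∣ minimalDiscriminantInt W)
    (hA : ¬ (p : ℤ) ∣ minimalDiscriminantInt A) (hap : W.frobeniusTrace p = A.frobeniusTrace p) :
    ∃ ψ : ℚ_[p]⟦X⟧, constantCoeff ψ = 0 ∧ (∀ n, ‖coeff n ψ‖ ≤ 1) ∧
      (A.map (algebraMap ℚ ℚ_[p])).formalLog.subst ψ = (W.map (algebraMap ℚ ℚ_[p])).formalLog := by
  set logA := (A.map (algebraMap ℚ ℚ_[p])).formalLog with hlogA
  set logW := (W.map (algebraMap ℚ ℚ_[p])).formalLog with hlogW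
  have hA0 : constantCoeff logA = 0 := constantCoeff_formalLog _
  have hA1 : coeff 1 logA = 1 := coeff_one_formalLog _
  have hunit : IsUnit (coeff 1 logA) := by rw [hA1]; exact isUnit_one
  have hW0 : constantCoeff logW = 0 := constantCoeff_formalLog _
  have hsW : HasSubst logW := HasSubst.of_constantCoeff_zero' hW0
  set inv := logA.substInvOfIsUnit hunit with hinv
  have hsinv : HasSubst inv := HasSubst.substInvOfIsUnit logA hunit
  set ψ := inv.subst logW with hψ
  have hψ0 : constantCoeff ψ = 0 :=
    constantCoeff_subst_eq_zero hW0 inv (constantCoeff_substInvOfIsUnit logA hunit)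
  have hlogψ : logA.subst ψ = logW := by
    rw [hψ, ← subst_comp_subst_apply hsinv hsW, hinv, subst_substInvOfIsUnit_right logA hA0 hunit, subst_X hsW]
  refine ⟨ψ, hψ0, fun n ↦ ?_, hlogψ⟩
  -- both logarithms are of Honda type `p − a_pT + T²` with the SAME `a_p`
  have ha : ‖((A.frobeniusTrace p : ℤ) : ℚ_[p])‖ ≤ 1 := Padic.norm_int_le_one _
  have hT₁ : ∀ m, ‖coeff m (hondaShift p ((A.frobeniusTrace p : ℤ) : ℚ_[p]) logA)‖ ≤ 1 := fun m ↦ by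
    have h := norm_coeff_hondaShift_subst_formalLog_le_one' A hA (θ := PowerSeries.X)
      constantCoeff_X (fun k ↦ by rw [coeff_X]; split_ifs <;> simp) m
    rwa [powerSeries_subst_X_self] at h
  have hT₂ : ∀ m, ‖coeff m (hondaShift p ((A.frobeniusTrace p : ℤ) : ℚ_[p]) logW)‖ ≤ 1 := fun m ↦ by
    have h := norm_coeff_hondaShift_subst_formalLog_le_one' W hW (θ := PowerSeries.X)
      constantCoeff_X (fun k ↦ by rw [coeff_X]; split_ifs <;> simp) m
    rwa [powerSeries_subst_X_self, hap] at h
  have h1 : ‖coeff 1 logA‖ = 1 := by rw [hA1, norm_one]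
  exact norm_coeff_le_one_of_subst_eq ha hT₁ hT₂ h1 hψ0 hlogψ n

/-- **The habitat case: `Ŵ ≅ Â` strongly over `ℤ₂`.** For `W`, `A` globally minimal, good supersingular at `2` with
`a₂(W) = a₂(A) = 0` (the theta habitat and its CM partner), there is `ψ ∈ Xℤ₂⟦X⟧` with `log_{A ⊗ ℚ₂}(ψ) = log_{W ⊗ ℚ₂}`
(both formal groups have Honda type `2 + T²`; Kim 2009 p. 186 / Kobayashi Thm. 8.4 READ AT `2`, at the power-series level).
[cite: Honda1970, Thm. 2 and Thm. 9] [cite: Kobayashi2003, Thm. 8.4] [cite: BDKim2009, p. 186 (proof of Prop. 2.11–2.12)] -/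
theorem exists_padicInt_formalLog_subst_eq_formalLog_two_of_goodSS (W A : WeierstrassCurve ℚ) [W.IsElliptic]
    [W.IsGloballyMinimal] [A.IsElliptic] [A.IsGloballyMinimal] (hW : GoodSS W 2) (hWa : W.frobeniusTrace 2 = 0)
    (hA : GoodSS A 2) (hAa : A.frobeniusTrace 2 = 0) :
    ∃ ψ : ℚ_[2]⟦X⟧, constantCoeff ψ = 0 ∧ (∀ n, ‖coeff n ψ‖ ≤ 1) ∧
      (A.map (algebraMap ℚ ℚ_[2])).formalLog.subst ψ = (W.map (algebraMap ℚ ℚ_[2])).formalLog :=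
  exists_padicInt_formalLog_subst_eq_formalLog W A
    (not_dvd_minimalDiscriminantInt_of_hasGoodReductionAtPrime' W 2 hW.1)
    (not_dvd_minimalDiscriminantInt_of_hasGoodReductionAtPrime' A 2 hA.1) (by rw [hWa, hAa])

end Summit.BirchSwinnertonDyer.BirchSwinnertonDyer.Theorems.SignedTransportAtTwo

end
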